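import Summits.RiemannHypothesis.RiemannHypothesis.Theorems.ThetaTier2RowSound
import HarnessLib

/-!
# THETA tier-2 kernel rows — twin primes `179 ≤ q ≤ 617` (module 1 of 13; cc-s2-1, WEIL typing lane; RH-FREE bookkeeping)

Data module of the tier-2 theta certificate (THETA-CERT-cc6 §E; HOME/cc-s2-1/gen22/TIER2-KERNEL-SPEC.md; soundness chain
`ThetaTier2Check … ThetaTier2RowSound`): the rows `(q, q⁺, m, δ·10¹², menu, k)` — `m = 5`, `δ = ⌊0.98·δ_q·10¹²⌋/10¹²` with
`δ_q = ½ log(q⁺/q)`, menu `0` = thin seed `(1/20, 19/20, 1)`, `η′ = 1/100` (menu `1` = `(1/4, 3/5, 1)`, `η′ = 1/20` for `q = 179, 191`),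
`t₀ = 2⁻¹⁵`; `K = 6`, `τ = 1/100`, `D = 3`, `W_l = 4`, `J = 64` — for the twin primes `179 ≤ q ≤ 617` in the range of the route item
`stmt-RiemannHypothesis-19172` (`WallsTenKTwin`, `route-RiemannHypothesis-WeilSemilocal`), checked in the kernel by `Row2.check`
(`decide +kernel`, ≈ 14 s per row), and the resulting REAL statements `T2Valid r.inp r.real ∧ r.RowFacts` (`Row2.check_sound`) that the
E-side assembly turns into `UC(q)`.  Nothing here bears on the truth of RH.
-/

set_option linter.dupNamespace false  -- the mandated namespace repeats `RiemannHypothesis`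

namespace Summit.RiemannHypothesis.RiemannHypothesis.Theorems.ThetaTier2

/-- Twin rows `179 ≤ q ≤ 311` (8 rows). [this cell, TIER2-KERNEL-SPEC §4] -/
def twinRows01_1 : List Row2 := [
  ⟨179, 181, 5, 5444500458, 1, 15⟩, ⟨191, 193, 5, 5104212820, 1, 15⟩, ⟨197, 199, 5, 4949537033, 0, 15⟩, ⟨227, 229, 5, 4298273175, 0, 15⟩,
  ⟨239, 241, 5, 4083356963, 0, 15⟩, ⟨269, 271, 5, 3629646226, 0, 15⟩, ⟨281, 283, 5, 3475191871, 0, 15⟩, ⟨311, 313, 5, 3141036396, 0, 15⟩ ]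

/-- The kernel verdict for `twinRows01_1`. [this cell, THETA-CERT-cc6 §E6] -/
theorem twinRows01_1_check : twinRows01_1.all Row2.check = true := by
  decide +kernel

/-- (K1)–(K7) and the row facts at every row of `twinRows01_1`. [this cell, THETA-CERT-cc6 §E6] -/
theorem twinRows01_1_valid : ∀ r ∈ twinRows01_1, T2Valid r.inp r.real ∧ r.RowFacts :=
  fun r hr => r.check_sound (List.all_eq_true.1 twinRows01_1_check r hr)

/-- Twin rows `347 ≤ q ≤ 617` (8 rows). [this cell, TIER2-KERNEL-SPEC §4] -/
def twinRows01_2 : List Row2 := [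
  ⟨347, 349, 5, 2816099705, 0, 15⟩, ⟨419, 421, 5, 2333337742, 0, 15⟩, ⟨431, 433, 5, 2268522570, 0, 15⟩, ⟨461, 463, 5, 2121215433, 0, 15⟩,
  ⟨521, 523, 5, 1877396932, 0, 15⟩, ⟨569, 571, 5, 1719300009, 0, 15⟩, ⟨599, 601, 5, 1633334845, 0, 15⟩, ⟨617, 619, 5, 1585761901, 0, 15⟩ ]

/-- The kernel verdict for `twinRows01_2`. [this cell, THETA-CERT-cc6 §E6] -/
theorem twinRows01_2_check : twinRows01_2.all Row2.check = true := by
  decide +kernel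

/-- (K1)–(K7) and the row facts at every row of `twinRows01_2`. [this cell, THETA-CERT-cc6 §E6] -/
theorem twinRows01_2_valid : ∀ r ∈ twinRows01_2, T2Valid r.inp r.real ∧ r.RowFacts :=
  fun r hr => r.check_sound (List.all_eq_true.1 twinRows01_2_check r hr)

end Summit.RiemannHypothesis.RiemannHypothesis.Theorems.ThetaTier2
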